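import Literature.MathematicalPhysics.QuantumLattice.HubbardDressedClusterTorusState
import Literature.MathematicalPhysics.QuantumLattice.FermionBoxProductMarginalsParts
import HarnessLib

/-!
# The seam-dressed cluster trial state on the torus: every dressed local term equals the `ℤ²` functional `locE`

Topic `Literature/MathematicalPhysics/QuantumLattice` (namespace = path; family `hubbard`). The per-term reduction of
certificate **C3** of the `T > 0` Hubbard programme: for the trial state `ρ' = W (Π_v Γ_{box v} σ) Wᴴ` on the square torus
`L = K_x a = K_y b` (`HubbardDressedClusterTorusState.lean`) and a local term `h ∈ 𝔄_S`, `S ⊆ [−a,2a)×[−b,2b)` placed in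
the torus by `x ↦ x mod L`,

  `tr(ρ' · Γ(h)) = tr_{𝔄_Λ(S)} [ M_Λ(σ) · W_Λᴴ · Γ_{S⊆Λ}(h) · W_Λ ]`   (`trace_trialState_mul_fermionEmbed_window`),

whose real part is `SeamDressed.locE … S h` of `HubbardDressedClusterEnergyFunctional.lean` — the torus has
disappeared. Ingredients: `tr(WρWᴴX) = tr(ρ WᴴXW)`; the LIGHT CONE of the gate layer
(`conjTranspose_boxProd_univ_mul_mul_eq`: only the torus gates meeting `S mod L` survive, and these are exactly the
box translates `(g, w) ∈ meet S` read modulo `(K_x, K_y)` — `K_x, K_y ≥ 9` makes this identification injective); its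
local form inside the window `Λ(S) mod L` (`conjTranspose_boxProd_map_mul_fermionEmbed_mul_eq`); the defining duality of
the partial trace; and the MARGINAL of the box product on the window (`fermionPartialTrace_boxProd_parts`: the parts of
`Λ(S)` are its intersections with the box translates, read back in the reference box by `y ↦ y − z(w)`).

* §1 index bookkeeping: `idx` (an offset `w ∈ ℤ²` read as a torus box index through the integer casts `ℤ → Fin K`), `torusPt_add_boxVec_idx`
  (`(y + z(idx w)) mod L = (y + z(w)) mod L`), bounds on windows and offsets, the window leg `windowLegT`;
* §2 `trace_trialState_mul_fermionEmbed_window`.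

Everything is PROVED; the definitions are index maps; no named fact.

## References

* M. Kliesch, C. Gogolin, M. J. Kastoryano, A. Riera, J. Eisert, Phys. Rev. X 4 (2014) 031019, §II. [cite: KlieschEtAl2014, §II]
* O. Bratteli, D. W. Robinson, *Operator Algebras and Quantum Statistical Mechanics 2* (1997), §5.2.2. [cite: BratteliRobinsonII1997, §5.2.2]
* H. Araki, H. Moriya, Rev. Math. Phys. 15 (2003) 93, §4.1, §11.1. [cite: ArakiMoriya2003, §11.1 Theorem 11.2]
-/

noncomputable section

namespace Literature.MathematicalPhysics.QuantumLattice

open Matrix Finset HubbardWave0 Literature.Probability.LatticeModels AndersonCluster ThermodynamicLimit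
open scoped ComplexOrder BigOperators Fin.IntCast

namespace SeamDressed

/-! ### §1. Offsets modulo the number of boxes; window bounds; the window leg -/

section Index

/-- `(z : Fin K) ≡ z (mod K)`: `K ∣ z − (z : Fin K)` (the library's integer cast into `Fin K`, `Fin.val_intCast`).
[cite: FriedliVelenik2017, §3.1] -/
theorem dvd_sub_intCast_fin (K : ℕ) [NeZero K] (z : ℤ) : (K : ℤ) ∣ z - (((z : Fin K) : ℕ) : ℤ) := by
  have hK : (0 : ℤ) < K := by exact_mod_cast Nat.pos_of_ne_zero (NeZero.ne K)
  have h : (((z : Fin K) : ℕ) : ℤ) = z % K := by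
    rw [Fin.val_intCast]
    exact Int.toNat_of_nonneg (Int.emod_nonneg z hK.ne')
  rw [h, Int.emod_def]
  exact ⟨z / K, by ring⟩

/-- `((v + K q : ℤ) : Fin K) = v` for `v ∈ Fin K`. [cite: FriedliVelenik2017, §3.1] -/
theorem intCast_fin_coe_add_mul (K : ℕ) [NeZero K] (v : Fin K) (q : ℤ) : ((((v : ℕ) : ℤ) + K * q : ℤ) : Fin K) = v := by
  apply Fin.ext
  rw [Fin.val_intCast, Int.add_mul_emod_self_left, Int.emod_eq_of_lt (by positivity) (by exact_mod_cast v.isLt)]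
  exact Int.toNat_natCast _

/-- The cast `ℤ → Fin K` is injective on integers closer than `K`. [cite: FriedliVelenik2017, §3.1] -/
theorem eq_of_intCast_fin_eq (K : ℕ) [NeZero K] {z z' : ℤ} (h : (z : Fin K) = (z' : Fin K)) (hlt : |z - z'| < K) :
    z = z' := by
  have h1 := dvd_sub_intCast_fin K z
  have h2 := dvd_sub_intCast_fin K z'
  have hv : (((z : Fin K) : ℕ) : ℤ) = (((z' : Fin K) : ℕ) : ℤ) := by rw [h]
  have hd : (K : ℤ) ∣ z - z' := by
    obtain ⟨p, hp⟩ := h1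
    obtain ⟨q, hq⟩ := h2
    exact ⟨p - q, by linarith⟩
  exact sub_eq_zero.1 (Int.eq_zero_of_abs_lt_dvd hd hlt)

variable (a b : ℕ) [NeZero a] [NeZero b] (L : ℕ) [NeZero L] {Kx Ky : ℕ} [NeZero Kx] [NeZero Ky]
  (hLx : (L : ℤ) = Kx * a) (hLy : (L : ℤ) = Ky * b)

/-- **An offset `w ∈ ℤ²` read as a torus box index** `(w₁ mod K_x, w₂ mod K_y)` (integer casts into `Fin`).
[cite: FriedliVelenik2017, §3.1] -/
def idx (w : ℤ × ℤ) : Fin Kx × Fin Ky := ((w.1 : Fin Kx), (w.2 : Fin Ky))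

include hLx hLy

omit [NeZero a] [NeZero b] in
/-- `z(idx w) ≡ z(w) (mod L)`: `(y + z(idx w)) mod L = (y + z(w)) mod L`. [cite: FriedliVelenik2017, §3.1] -/
theorem torusPt_add_boxVec_idx (y : Site 2) (w : ℤ × ℤ) :
    torusPt L (y + boxVec a b (idx (Kx := Kx) (Ky := Ky) w)) = torusPt L (y + latticeVec a b w) := by
  rw [torusPt_eq_iff]
  intro i
  fin_cases i
  · show (L : ℤ) ∣ (y 0 + (((w.1 : Fin Kx) : ℕ) : ℤ) * a) - (y 0 + w.1 * a)
    rw [hLx]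
    obtain ⟨q, hq⟩ := dvd_sub_intCast_fin Kx w.1
    exact ⟨-q, by linear_combination (-(a : ℤ)) * hq⟩
  · show (L : ℤ) ∣ (y 1 + (((w.2 : Fin Ky) : ℕ) : ℤ) * b) - (y 1 + w.2 * b)
    rw [hLy]
    obtain ⟨q, hq⟩ := dvd_sub_intCast_fin Ky w.2
    exact ⟨-q, by linear_combination (-(b : ℤ)) * hq⟩

variable {m : ℕ} (G : Fin m → Finset (Site 2)) (hG : ∀ g, G g ⊆ gateRange a b)
include hG

omit [NeZero L] [NeZero Kx] [NeZero Ky] hLx hLy in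
/-- **Offsets of meeting gates are small**: if `G g + z(w)` meets `S ⊆ [−a,2a)×[−b,2b)` then `|w₁|, |w₂| ≤ 2`.
[cite: FriedliVelenik2017, §3.1] -/
theorem abs_le_two_of_mem_meet {S : Finset (Site 2)} (hS : S ⊆ gateRange a b) {k : Fin m × (ℤ × ℤ)}
    (hk : k ∈ meet a b G S) : |k.2.1| ≤ 2 ∧ |k.2.2| ≤ 2 := by
  obtain ⟨-, hmeet⟩ := Finset.mem_filter.1 hk
  rw [Finset.not_disjoint_iff] at hmeet
  obtain ⟨s, hs1, hs2⟩ := hmeet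
  rw [mem_shiftSet] at hs1
  have hb := abs_sub_lt_of_mem_gateRange a b (hS hs2) (hG k.1 hs1)
  have ha0 : (0 : ℤ) < a := by exact_mod_cast Nat.pos_of_ne_zero (NeZero.ne a)
  have hb0 : (0 : ℤ) < b := by exact_mod_cast Nat.pos_of_ne_zero (NeZero.ne b)
  have e0 : s 0 - (s - latticeVec a b k.2) 0 = k.2.1 * a := by simp
  have e1 : s 1 - (s - latticeVec a b k.2) 1 = k.2.2 * b := by simp
  rw [e0] at hb
  rw [e1] at hb
  obtain ⟨h0, h1⟩ := hb
  rw [abs_mul, abs_of_pos ha0] at h0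
  rw [abs_mul, abs_of_pos hb0] at h1
  constructor
  · by_contra hc
    rw [not_le] at hc
    have : (3 : ℤ) * a ≤ |k.2.1| * a := by nlinarith
    linarith
  · by_contra hc
    rw [not_le] at hc
    have : (3 : ℤ) * b ≤ |k.2.2| * b := by nlinarith
    linarith

omit [NeZero L] [NeZero Kx] [NeZero Ky] hLx hLy in
/-- **Windows are small**: every site of `Λ(S)` (`S ⊆ [−a,2a)×[−b,2b)`) has `−3a ≤ y₀ < 4a`, `−3b ≤ y₁ < 4b`.
[cite: FriedliVelenik2017, §3.1] -/
theorem mem_window_bounds {S : Finset (Site 2)} (hS : S ⊆ gateRange a b) {y : Site 2} (hy : y ∈ window a b G S) :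
    (-(3 * a : ℤ) ≤ y 0 ∧ y 0 < 4 * a) ∧ (-(3 * b : ℤ) ≤ y 1 ∧ y 1 < 4 * b) := by
  have hrange : ∀ z ∈ gateRange a b, (-(a : ℤ) ≤ z 0 ∧ z 0 < 2 * a) ∧ (-(b : ℤ) ≤ z 1 ∧ z 1 < 2 * b) := by
    intro z hz
    rw [gateRange, mem_shiftSet, mem_rectWindow_iff] at hz
    have e0 : (z - -latticeVec a b (1, 1)) 0 = z 0 + a := by simp [latticeVec]
    have e1 : (z - -latticeVec a b (1, 1)) 1 = z 1 + b := by simp [latticeVec]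
    rw [e0, e1] at hz
    push_cast at hz
    obtain ⟨⟨h1, h2⟩, h3, h4⟩ := hz
    refine ⟨⟨by linarith, by linarith⟩, by linarith, by linarith⟩
  rw [window, Finset.mem_union] at hy
  rcases hy with hy | hy
  · have h := hrange y (hS hy)
    have : (0 : ℤ) ≤ a := by positivity
    have : (0 : ℤ) ≤ b := by positivity
    refine ⟨⟨by linarith [h.1.1], by linarith [h.1.2]⟩, by linarith [h.2.1], by linarith [h.2.2]⟩
  · rw [Finset.mem_biUnion] at hy
    obtain ⟨k, hk, hyk⟩ := hy
    have hw := abs_le_two_of_mem_meet a b G hG hS hk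
    rw [mem_shiftSet] at hyk
    have h := hrange _ (hG k.1 hyk)
    simp only [Pi.sub_apply, latticeVec_zero, latticeVec_one] at h
    have ha0 : (0 : ℤ) ≤ a := by positivity
    have hb0 : (0 : ℤ) ≤ b := by positivity
    obtain ⟨hw1, hw2⟩ := hw
    rw [abs_le] at hw1 hw2
    refine ⟨⟨by nlinarith [h.1.1], by nlinarith [h.1.2]⟩, by nlinarith [h.2.1], by nlinarith [h.2.2]⟩

variable (hK : 9 ≤ Kx ∧ 9 ≤ Ky)
include hK

omit [NeZero Kx] [NeZero Ky] in
/-- **`x ↦ x mod L` is injective on every window** (`K_x, K_y ≥ 9`). [cite: FriedliVelenik2017, §3.1] -/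
theorem eq_of_torusPt_eq_of_mem_window {S : Finset (Site 2)} (hS : S ⊆ gateRange a b) {y y' : Site 2}
    (hy : y ∈ window a b G S) (hy' : y' ∈ window a b G S) (h : torusPt L y = torusPt L y') : y = y' := by
  have h1 := mem_window_bounds a b G hG hS hy
  have h2 := mem_window_bounds a b G hG hS hy'
  have hLa : (9 : ℤ) * a ≤ L := by
    rw [hLx]; have : (9 : ℤ) ≤ Kx := by exact_mod_cast hK.1
    have : (0 : ℤ) ≤ a := by positivity
    nlinarith
  have hLb : (9 : ℤ) * b ≤ L := by
    rw [hLy]; have : (9 : ℤ) ≤ Ky := by exact_mod_cast hK.2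
    have : (0 : ℤ) ≤ b := by positivity
    nlinarith
  refine eq_of_torusPt_eq L h fun i => ?_
  fin_cases i
  · show |y 0 - y' 0| < L
    rw [abs_sub_lt_iff]; constructor <;> linarith [h1.1.1, h1.1.2, h2.1.1, h2.1.2]
  · show |y 1 - y' 1| < L
    rw [abs_sub_lt_iff]; constructor <;> linarith [h1.2.1, h1.2.2, h2.2.1, h2.2.2]

omit [NeZero Kx] [NeZero Ky] in
/-- **The leg of a window into the torus**: `y ↦ y mod L` on `Λ(S)`. [cite: ArakiMoriya2003, §4.1 Def. 4.3] -/
def windowLegT (S : Finset (Site 2)) (hS : S ⊆ gateRange a b) : PolySite (window a b G S) ↪ FermionTorus 2 L :=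
  ⟨fun y => torusPt L (ofLex y.1), fun y y' h => Subtype.ext (congrArg toLex
    (eq_of_torusPt_eq_of_mem_window a b L hLx hLy G hG hK hS (PolySite.ofLex_mem y) (PolySite.ofLex_mem y') h))⟩

omit [NeZero Kx] [NeZero Ky] in
/-- The window leg on an ordered site. [cite: ArakiMoriya2003, §4.1 Def. 4.3] -/
@[simp] theorem windowLegT_apply (S : Finset (Site 2)) (hS : S ⊆ gateRange a b) (y : PolySite (window a b G S)) :
    windowLegT a b L hLx hLy G hG hK S hS y = torusPt L (ofLex y.1) := rfl

omit [NeZero L] hLx hLy in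
/-- **Distinct offsets met by a window stay distinct modulo `(K_x, K_y)`** (`K_x, K_y ≥ 9`; offsets lie in `[−4,4]²`).
[cite: FriedliVelenik2017, §3.1] -/
theorem idx_injOn_boxOffsets {S : Finset (Site 2)} (hS : S ⊆ gateRange a b) {w w' : ℤ × ℤ}
    (hw : w ∈ boxOffsets a b G S) (hw' : w' ∈ boxOffsets a b G S)
    (h : idx (Kx := Kx) (Ky := Ky) w = idx w') : w = w' := by
  obtain ⟨y, hy, rfl⟩ := Finset.mem_image.1 hw
  obtain ⟨y', hy', rfl⟩ := Finset.mem_image.1 hw'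
  have h1 := mem_window_bounds a b G hG hS hy
  have h2 := mem_window_bounds a b G hG hS hy'
  have ha : (0 : ℤ) < a := by exact_mod_cast Nat.pos_of_ne_zero (NeZero.ne a)
  have hb : (0 : ℤ) < b := by exact_mod_cast Nat.pos_of_ne_zero (NeZero.ne b)
  -- `⌊c/q⌋ ∈ [−3, 3]` for `−3q ≤ c < 4q`
  have bound : ∀ (c q : ℤ), 0 < q → -(3 * q) ≤ c → c < 4 * q → -3 ≤ c / q ∧ c / q ≤ 3 := by
    intro c q hq hlo hhi
    constructor
    · exact Int.le_ediv_of_mul_le hq (by linarith)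
    · have := Int.ediv_lt_of_lt_mul hq (show c < 4 * q by linarith)
      omega
  have b1 := bound (y 0) a ha h1.1.1 h1.1.2
  have b2 := bound (y 1) b hb h1.2.1 h1.2.2
  have b3 := bound (y' 0) a ha h2.1.1 h2.1.2
  have b4 := bound (y' 1) b hb h2.2.1 h2.2.2
  have hKx : (9 : ℤ) ≤ Kx := by exact_mod_cast hK.1
  have hKy : (9 : ℤ) ≤ Ky := by exact_mod_cast hK.2
  have e1 : (boxOf a b y).1 = (boxOf a b y').1 :=
    eq_of_intCast_fin_eq Kx (congrArg Prod.fst h) (by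
      show |y 0 / a - y' 0 / a| < Kx
      rw [abs_sub_lt_iff]; constructor <;> linarith [b1.1, b1.2, b3.1, b3.2])
  have e2 : (boxOf a b y).2 = (boxOf a b y').2 :=
    eq_of_intCast_fin_eq Ky (congrArg Prod.snd h) (by
      show |y 1 / b - y' 1 / b| < Ky
      rw [abs_sub_lt_iff]; constructor <;> linarith [b2.1, b2.2, b4.1, b4.2])
  exact Prod.ext e1 e2

end Index

/-! ### §2. The per-term reduction -/

section Reduction

variable (a b : ℕ) [NeZero a] [NeZero b] (L : ℕ) [NeZero L] {Kx Ky : ℕ} [NeZero Kx] [NeZero Ky]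
  (hLx : (L : ℤ) = Kx * a) (hLy : (L : ℤ) = Ky * b)
  {m : ℕ} (G : Fin m → Finset (Site 2)) (hG : ∀ g, G g ⊆ gateRange a b) (hK3 : 3 ≤ Kx ∧ 3 ≤ Ky) (hK : 9 ≤ Kx ∧ 9 ≤ Ky)
  (hsep : ∀ g g', ∀ x ∈ G g, ∀ x' ∈ G g', ((a : ℤ) ∣ x' 0 - x 0) → ((b : ℤ) ∣ x' 1 - x 1) → g = g' ∧ x = x')
  (u : ∀ g, FermionOp (G g)) (hu : ∀ g, parityAut (u g) = u g) (huU : ∀ g, (u g)ᴴ * u g = 1)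
  (σ : FermionOp (rectWindow a b)) (hσ : parityAut σ = σ) (hσtr : σ.trace = 1)

/-- (Local to this file.) Equality of torus sites is decided through the linear order — the instance the generic
Jordan–Wigner lemmas carry. [folklore] -/
noncomputable local instance (priority := high) instDecidableEqFermionTorusSeamDressedEnergy : DecidableEq (FermionTorus 2 L) :=
  LinearOrder.toDecidableEq

/-- **The meeting gates as torus gates**: `(g, w) ↦ (g, idx w)`, injective for `S ⊆ [−a,2a)×[−b,2b)` and `K_x, K_y ≥ 9`
(offsets of meeting gates lie in `[−2,2]²`). [cite: FriedliVelenik2017, §3.1] -/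
def meetEmb (S : Finset (Site 2)) (hS : S ⊆ gateRange a b) : ↥(meet a b G S) ↪ Fin m × (Fin Kx × Fin Ky) :=
  ⟨fun k => (k.1.1, idx k.1.2), fun k j h => by
    have h' : (k.1.1, idx (Kx := Kx) (Ky := Ky) k.1.2) = (j.1.1, idx j.1.2) := h
    obtain ⟨h1, h2⟩ := Prod.mk.inj h'
    obtain ⟨bk1, bk2⟩ := abs_le_two_of_mem_meet a b G hG hS k.2
    obtain ⟨bj1, bj2⟩ := abs_le_two_of_mem_meet a b G hG hS j.2
    have hKx : (9 : ℤ) ≤ Kx := by exact_mod_cast hK.1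
    have hKy : (9 : ℤ) ≤ Ky := by exact_mod_cast hK.2
    rw [abs_le] at bk1 bk2 bj1 bj2
    have e1 : k.1.2.1 = j.1.2.1 := eq_of_intCast_fin_eq Kx (congrArg Prod.fst h2)
      (by rw [abs_sub_lt_iff]; constructor <;> linarith [bk1.1, bk1.2, bj1.1, bj1.2])
    have e2 : k.1.2.2 = j.1.2.2 := eq_of_intCast_fin_eq Ky (congrArg Prod.snd h2)
      (by rw [abs_sub_lt_iff]; constructor <;> linarith [bk2.1, bk2.2, bj2.1, bj2.2])
    exact Subtype.ext (Prod.ext h1 (Prod.ext e1 e2))⟩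

/-- `meetEmb` on an element. [cite: FriedliVelenik2017, §3.1] -/
@[simp] theorem meetEmb_apply (S : Finset (Site 2)) (hS : S ⊆ gateRange a b) (k : ↥(meet a b G S)) :
    meetEmb a b G hG hK S hS k = (k.1.1, idx (Kx := Kx) (Ky := Ky) k.1.2) := rfl

include hLx hLy in
/-- **A torus gate meeting `S mod L` is a meeting gate**: if the torus gate `(g, v)` shares a torus site with `S mod L`
then `(g, v)` is in the image of `meetEmb`. [cite: BratteliRobinsonII1997, §5.2.2] -/
theorem mem_map_meetEmb_of_not_disjoint (S : Finset (Site 2)) (hS : S ⊆ gateRange a b) {k : Fin m × (Fin Kx × Fin Ky)}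
    {y : Site 2} (hy : y ∈ G k.1) {s : Site 2} (hs : s ∈ S) (h : torusPt L (y + boxVec a b k.2) = torusPt L s) :
    k ∈ (Finset.univ : Finset ↥(meet a b G S)).map (meetEmb a b G hG hK S hS) := by
  rw [torusPt_eq_iff] at h
  obtain ⟨q0, hq0⟩ := h 0
  obtain ⟨q1, hq1⟩ := h 1
  simp only [Pi.add_apply, boxVec_zero, boxVec_one] at hq0 hq1
  rw [hLx] at hq0
  rw [hLy] at hq1
  -- the exact offset `w` with `s = y + z(w)`
  set w : ℤ × ℤ := (((k.2.1 : ℕ) : ℤ) - Kx * q0, ((k.2.2 : ℕ) : ℤ) - Ky * q1) with hw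
  have hsw : s = y + latticeVec a b w := by
    funext i
    fin_cases i
    · show s 0 = (y + latticeVec a b w) 0
      simp only [Pi.add_apply, latticeVec_zero, hw]
      linear_combination -hq0
    · show s 1 = (y + latticeVec a b w) 1
      simp only [Pi.add_apply, latticeVec_one, hw]
      linear_combination -hq1
  have hmeet : (k.1, w) ∈ meet a b G S := by
    refine Finset.mem_filter.2 ⟨Finset.mem_product.2 ⟨Finset.mem_univ _, ?_⟩, ?_⟩
    · refine Finset.mem_image.2 ⟨(s, y), Finset.mem_product.2 ⟨hs, Finset.mem_biUnion.2 ⟨k.1, Finset.mem_univ _, hy⟩⟩, ?_⟩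
      show boxOf a b (s - y) = w
      refine boxOf_eq_of_sub_latticeVec_mem a b ?_
      rw [hsw, add_sub_cancel_left, sub_self]
      rw [mem_rectWindow_iff]
      simp only [Pi.zero_apply]
      have : 0 < a := Nat.pos_of_ne_zero (NeZero.ne a)
      have : 0 < b := Nat.pos_of_ne_zero (NeZero.ne b)
      exact ⟨⟨le_rfl, by exact_mod_cast ‹0 < a›⟩, le_rfl, by exact_mod_cast ‹0 < b›⟩
    · rw [Finset.not_disjoint_iff]
      exact ⟨s, mem_shiftSet.2 (by rw [hsw, add_sub_cancel_right]; exact hy), hs⟩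
  refine Finset.mem_map.2 ⟨⟨(k.1, w), hmeet⟩, Finset.mem_univ _, ?_⟩
  rw [meetEmb_apply]
  refine Prod.ext rfl ?_
  show idx w = k.2
  refine Prod.ext ?_ ?_
  · show (Int.cast (((k.2.1 : ℕ) : ℤ) - Kx * q0) : Fin Kx) = k.2.1
    have := intCast_fin_coe_add_mul Kx k.2.1 (-q0)
    rwa [mul_neg, ← sub_eq_add_neg] at this
  · show (Int.cast (((k.2.2 : ℕ) : ℤ) - Ky * q1) : Fin Ky) = k.2.2
    have := intCast_fin_coe_add_mul Ky k.2.2 (-q1)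
    rwa [mul_neg, ← sub_eq_add_neg] at this

/-- The box-offset map of a window as an injection into the torus boxes. [cite: FriedliVelenik2017, §3.1] -/
def offsetIdx (S : Finset (Site 2)) (w : ↥(boxOffsets a b G S)) : Fin Kx × Fin Ky := idx w.1

omit [NeZero a] [NeZero b] [NeZero L] [NeZero Kx] [NeZero Ky] in
/-- `tr(W ρ Wᴴ X) = tr(ρ (Wᴴ X W))`. [folklore] -/
private theorem trace_conj_mul {n : Type*} [Fintype n] [DecidableEq n] (W ρ X : Matrix n n ℂ) :
    (W * ρ * Wᴴ * X).trace = (ρ * (Wᴴ * X * W)).trace := by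
  rw [Matrix.mul_assoc, Matrix.mul_assoc, Matrix.trace_mul_comm, Matrix.mul_assoc, Matrix.mul_assoc]

include hLx hLy huU hσtr in
/-- **THE PER-TERM REDUCTION.** For the seam-dressed trial state `ρ' = W (Π_v Γ_{box v} σ) Wᴴ` on the torus and a local
term `h ∈ 𝔄_S`, `S ⊆ [−a,2a) × [−b,2b)`, placed in the torus through its window:
`tr(ρ' · Γ(h)) = tr_{𝔄_Λ(S)} [ M_Λ(σ) · (W_Λᴴ · Γ_{S⊆Λ}(h) · W_Λ) ]` — light cone, local form, duality, marginal.
[cite: KlieschEtAl2014, §II] [cite: BratteliRobinsonII1997, §5.2.2] [cite: ArakiMoriya2003, §11.1 Theorem 11.2] -/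
theorem trace_trialState_mul_fermionEmbed_window (S : Finset (Site 2)) (hS : S ⊆ gateRange a b) (h : FermionOp S) :
    (trialState a b L hLx hLy G hG hK3 hsep u hu σ hσ *
        fermionEmbed ((PolySite.incl (subset_window a b G S)).trans (windowLegT a b L hLx hLy G hG hK S hS)) h).trace =
      (localMarginal a b G σ hσ S * ((localDressing a b G hsep u hu S)ᴴ *
        fermionEmbed (PolySite.incl (subset_window a b G S)) h * localDressing a b G hsep u hu S)).trace := by
  -- (1) `tr(W ρ Wᴴ X) = tr(ρ (Wᴴ X W))`
  rw [trialState, trace_conj_mul]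
  -- (2) light cone: only the meeting gates survive
  have hXmem : fermionEmbed ((PolySite.incl (subset_window a b G S)).trans (windowLegT a b L hLx hLy G hG hK S hS)) h ∈
      carSubalgebra (orbs ((Finset.univ : Finset (PolySite S)).map
        ((PolySite.incl (subset_window a b G S)).trans (windowLegT a b L hLx hLy G hG hK S hS)))) :=
    fermionEmbed_mem_carSubalgebra _ _
  have hD : ∀ k ∉ (Finset.univ : Finset ↥(meet a b G S)).map (meetEmb a b G hG hK S hS),
      Disjoint (boxOrbs (gateLegT a b L hLx hLy G hG hK3) k)
        (orbs ((Finset.univ : Finset (PolySite S)).map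
          ((PolySite.incl (subset_window a b G S)).trans (windowLegT a b L hLx hLy G hG hK S hS)))) := by
    intro k hk
    refine disjoint_orbs (Finset.disjoint_left.2 fun x hx hx' => hk ?_)
    obtain ⟨y, -, rfl⟩ := Finset.mem_map.1 hx
    obtain ⟨s, -, hs⟩ := Finset.mem_map.1 hx'
    have hs' : torusPt L (ofLex y.1 + boxVec a b k.2) = torusPt L (ofLex s.1) := hs.symm
    exact mem_map_meetEmb_of_not_disjoint a b L hLx hLy G hG hK S hS (PolySite.ofLex_mem y) (PolySite.ofLex_mem s) hs'
  rw [gateLayer, conjTranspose_boxProd_univ_mul_mul_eq (disjoint_gateLegT a b L hLx hLy G hG hK3 hsep) (fun k => hu k.1)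
    (fun k => huU k.1) _ hXmem hD]
  -- (3) local form inside the window
  have hcompat : ∀ (k' : ↥(meet a b G S)) (y : PolySite (G (meetEmb a b G hG hK S hS k').1)),
      gateLegT a b L hLx hLy G hG hK3 (meetEmb a b G hG hK S hS k') y =
        windowLegT a b L hLx hLy G hG hK S hS (gateLeg a b G S k' y) := by
    intro k' y
    show torusPt L (ofLex y.1 + boxVec a b (idx k'.1.2)) = torusPt L (ofLex (gateLeg a b G S k' y).1)
    rw [ofLex_coe_gateLeg]
    exact torusPt_add_boxVec_idx a b L hLx hLy _ _
  rw [conjTranspose_boxProd_map_mul_fermionEmbed_mul_eq (disjoint_gateLegT a b L hLx hLy G hG hK3 hsep) (fun k => hu k.1)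
    (windowLegT a b L hLx hLy G hG hK S hS) (meetEmb a b G hG hK S hS) (disjoint_gateLeg_of_sep a b G hsep S) hcompat
    (PolySite.incl (subset_window a b G S)) h]
  -- (4) duality and the marginal of the product state on the window
  rw [Matrix.trace_mul_comm, ← trace_mul_fermionPartialTrace]
  have hinj : Function.Injective (offsetIdx a b G (Kx := Kx) (Ky := Ky) S) := fun w w' hww' =>
    Subtype.ext (idx_injOn_boxOffsets a b G hG hK hS w.2 w'.2 hww')
  have hcardΩ : ∑ w : ↥(boxOffsets a b G S), Fintype.card (PolySite (part a b G S w.1)) =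
      Fintype.card (PolySite (window a b G S)) := by
    simp_rw [card_polySite]
    rw [Finset.card_eq_sum_card_fiberwise (f := boxOf a b) (s := window a b G S) (t := boxOffsets a b G S)
      (fun y hy => Finset.mem_image_of_mem _ hy), Finset.sum_coe_sort (boxOffsets a b G S) (fun w => (part a b G S w).card)]
    rfl
  have h5 : fermionPartialTrace (windowLegT a b L hLx hLy G hG hK S hS) (productState a b L hLx hLy σ hσ) =
      localMarginal a b G σ hσ S := by
    rw [productState, localMarginal]
    refine fermionPartialTrace_boxProd_parts (disjoint_boxLeg a b L hLx hLy) (windowLegT a b L hLx hLy G hG hK S hS)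
      (offsetIdx a b G S) hinj (fun w => partChart a b G S w.1) (fun w => PolySite.incl (part_subset_window a b G S w.1))
      (disjoint_partLeg a b G S) (fun w y => ?_)
      (fun y => ⟨boxOf a b (ofLex y.1), Finset.mem_image_of_mem _ (PolySite.ofLex_mem y)⟩)
      (fun y => PolySite.pt (ofLex y.1) (Finset.mem_filter.2 ⟨PolySite.ofLex_mem y, rfl⟩)) (fun y => rfl)
      (fun _ => hσ) (fun _ => hσtr) (sum_card_box_eq_card_torus a b L hLx hLy) hcardΩ
    -- compatibility of the part chart with the box leg: `((y − z(w)) + z(idx w)) mod L = y mod L`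
    show torusPt L ((ofLex y.1 - latticeVec a b w.1) + boxVec a b (idx w.1)) = torusPt L (ofLex y.1)
    rw [torusPt_add_boxVec_idx a b L hLx hLy, sub_add_cancel]
  rw [h5, Matrix.trace_mul_comm]
  rfl

end Reduction

end SeamDressed

end Literature.MathematicalPhysics.QuantumLattice

end
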